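import Mathlib

/-!
# NoGo / ViscousChannel — scalar skeleton of THEOREM N20 (the planar viscous channel is an
exact dichotomy for reference-scale level functionals; sufficiency half)

search for candidate a priori estimates; no regularity claim.

Setting (paper level, `pub-nsfunc-nogo/ephi/N20-VC.md`): F = Ω^Q ∫ Φ(|ω|/Ω) with a viscously
decaying reference frequency Ω ∈ {Ω_LD = Z²/ν³, Ω_RQ = νZ/K}, profile Φ ∈ C²[0,∞), Φ(0) = Φ′(0) = 0,
g_Φ(x) = (xΦ′ − QΦ)/x², m = inf Φ″, G⁺ = max (sup g_Φ) 0, c = c_ref ∈ {4 (LD), 2 (RQ)}.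
Along smooth solutions dF/dt = N_F + V_F with (Lemma N20.1, = N19 (a) / census (cc.33)(1) / (dd.41) B-i)
  V_F = −ν Ω^{Q−2} ∫ [Φ″(r)|∇|ω||² + (Φ′(r)/r)|ω|²|∇ξ|²] + γ · Ω^{Q−2} Z ⟨g_Φ⟩_Z,   0 ≤ γ ≤ c ν P / Z,
  N_F = Ω^{Q−2} ∫ σ · [Φ′(r)/r − c ⟨g_Φ⟩_Z].
THEOREM N20 (B): if m ≥ c · G⁺ then V_F ≤ 0 on every smooth field (so DICTIONARY §5 E0 gives
D_F = −V_F) and N_F ≤ Q‖α⁺‖∞ F (C = Q; C = cQ without the monotonicity of Φ/x^Q): the row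
`dF/dt + D_F ≤ C ‖α⁺‖∞ F` HOLDS, identity-type. The necessity half (A) (m < c·sup g ⇒ DEAD ∀C on
planar shear heat flows) is THEOREM N19 (d), two-party (census-2 VC-CHECK-B).

This file: the closed real-analysis / real-arithmetic steps.
* `floor_transfer` : Φ′(0) = 0 and Φ″ ≥ m on (0,∞) ⇒ Φ′(x) ≥ m x (mean value) — the tangential
  Hessian eigenvalue Φ′(r)/r of Φ∘|·| inherits the radial floor m (`tangential_floor`).
* `dissipation_density_floor`, `gain_le`, `viscous_nonpos` : V_F ≤ 0 under m ≥ c G⁺.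
* `inertial_weight_nonneg`, `production_density_le`, `production_le_QF`, `production_le_cQF`,
  `row_holds` : N_F ≤ Q‖α⁺‖∞F (resp. cQ) and the assembled row.
* `channel_upper`, `margin_upper` : the planar channel value ℛ = c_P 𝒥 − 𝒟 obeys
  ℛ ≤ Ω^{Q−2} P (c G⁺ − m) and, in the kill regime m ≤ cG⁺ with m > 0, ℛ/𝒟 ≤ cG⁺/m − 1
  (e.g. EΦ.q=2.LD.j=1: margin ≤ 4·1/2 − 1 = 1; observed 0.065 … 0.40, nogo TSa 0.10).
* `ld_q2j1_channel_open` : for Φ = x² log(e + x) the LD channel is open: Φ″(e/10) < 4·g_Φ(3e).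
All PDE bookkeeping (which integral is which) is hypothesis here and is documented in N20-VC.md §1.
-/

namespace Summit.NavierStokesRegularity.FunctionalMining.NoGo.ViscousChannel

open Set

/-- Lemma N20.2 (floor transfer). If `dΦ` (= Φ′) is continuous on `[0,∞)`, differentiable on
`(0,∞)` with derivative `≥ m` there, and `dΦ 0 = 0`, then `m * x ≤ dΦ x` for `x ≥ 0`. -/
theorem floor_transfer (dΦ : ℝ → ℝ) (m : ℝ) (hcont : ContinuousOn dΦ (Ici 0))
    (hdiff : DifferentiableOn ℝ dΦ (Ioi 0)) (hge : ∀ x, 0 < x → m ≤ deriv dΦ x)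
    (h0 : dΦ 0 = 0) : ∀ x, 0 ≤ x → m * x ≤ dΦ x := by
  intro x hx
  have hint : interior (Ici (0:ℝ)) = Ioi 0 := interior_Ici
  have key := (convex_Ici (0:ℝ)).mul_sub_le_image_sub_of_le_deriv hcont
    (by rw [hint]; exact hdiff) (fun y hy => hge y (by rw [hint] at hy; exact hy)) 0
    (mem_Ici.mpr le_rfl) x (mem_Ici.mpr hx) hx
  simpa [h0] using key

/-- The tangential Hessian eigenvalue `Φ′(x)/x` has the radial floor `m` (for `x > 0`). -/
theorem tangential_floor (dΦ : ℝ → ℝ) (m x : ℝ) (hx : 0 < x) (h : m * x ≤ dΦ x) :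
    m ≤ dΦ x / x := by
  rw [le_div_iff₀ hx]; exact h

/-- Pointwise dissipation floor: radial weight `wr ≥ m`, tangential weight `wt ≥ m`, gradient
pieces `a = |∇|ω||² ≥ 0`, `b = |ω|²|∇ξ|² ≥ 0` ⇒ `m (a + b) ≤ wr a + wt b` (integrates to D₁ ≥ ν m Ω^{Q-2} P). -/
theorem dissipation_density_floor (wr wt a b m : ℝ) (hr : m ≤ wr) (ht : m ≤ wt) (ha : 0 ≤ a)
    (hb : 0 ≤ b) : m * (a + b) ≤ wr * a + wt * b := by
  nlinarith [mul_le_mul_of_nonneg_right hr ha, mul_le_mul_of_nonneg_right ht hb]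

/-- The gain of the decaying reference scale: `V₂ = γ · w · Z · ḡ` with `0 ≤ γ ≤ c ν P / Z`,
`w = Ω^{Q-2} ≥ 0`, `ḡ ≤ G⁺`, `0 ≤ G⁺` ⇒ `V₂ ≤ c ν P · w · G⁺`. -/
theorem gain_le (γ c ν P Z w gbar Gp : ℝ) (hγ0 : 0 ≤ γ) (hγ : γ ≤ c * ν * P / Z) (hZ : 0 < Z)
    (hw : 0 ≤ w) (hGp : 0 ≤ Gp) (hg : gbar ≤ Gp) :
    γ * w * Z * gbar ≤ c * ν * P * w * Gp := by
  have h1 : γ * w * Z * gbar ≤ γ * w * Z * Gp :=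
    mul_le_mul_of_nonneg_left hg (by positivity)
  have h2 : γ * (w * Z * Gp) ≤ (c * ν * P / Z) * (w * Z * Gp) :=
    mul_le_mul_of_nonneg_right hγ (by positivity)
  have e : (c * ν * P / Z) * (w * Z * Gp) = c * ν * P * w * Gp := by
    field_simp
  calc γ * w * Z * gbar ≤ γ * w * Z * Gp := h1
    _ = γ * (w * Z * Gp) := by ring
    _ ≤ (c * ν * P / Z) * (w * Z * Gp) := h2
    _ = c * ν * P * w * Gp := e

/-- THEOREM N20 (B), viscous half: `V_F = -D₁ + V₂ ≤ 0` when `D₁ ≥ ν m w P` (floor),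
`V₂ ≤ c ν P w G⁺` (gain) and `c G⁺ ≤ m` (the survival condition (VC)). -/
theorem viscous_nonpos (D1 V2 ν m w P c Gp : ℝ) (hD : ν * m * w * P ≤ D1)
    (hV : V2 ≤ c * ν * P * w * Gp) (hm : c * Gp ≤ m) (hν : 0 ≤ ν) (hw : 0 ≤ w) (hP : 0 ≤ P) :
    -D1 + V2 ≤ 0 := by
  have h : (c * Gp) * (ν * w * P) ≤ m * (ν * w * P) :=
    mul_le_mul_of_nonneg_right hm (by positivity)
  have e1 : (c * Gp) * (ν * w * P) = c * ν * P * w * Gp := by ring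
  have e2 : m * (ν * w * P) = ν * m * w * P := by ring
  linarith [h, e1, e2]

/-- The inertial weight `W = Φ′(r)/r − c ḡ` is nonnegative: `Φ′(r)/r ≥ m ≥ c G⁺ ≥ c ḡ`. -/
theorem inertial_weight_nonneg (wt m c gbar Gp : ℝ) (ht : m ≤ wt) (hm : c * Gp ≤ m)
    (hg : gbar ≤ Gp) (hc : 0 ≤ c) : 0 ≤ wt - c * gbar := by
  nlinarith [mul_le_mul_of_nonneg_left hg hc]

/-- Pointwise production bound `σ W ≤ α⁺ s² W` (`σ ≤ α⁺ s²`, `W ≥ 0`). -/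
theorem production_density_le (σ aplus s W : ℝ) (hσ : σ ≤ aplus * s ^ 2) (hW : 0 ≤ W) :
    σ * W ≤ aplus * s ^ 2 * W :=
  mul_le_mul_of_nonneg_right hσ hW

/-- Integrated production bound, monotone case (`Φ/x^Q` nondecreasing, i.e. `ḡ ≥ 0`):
with `∫ |ω|² W = Q F / w + Z ḡ − c Z ḡ` (`w = Ω^{Q-2} > 0`) and `c ≥ 1`:  `N ≤ Q α⁺ F`. -/
theorem production_le_QF (N aplus F Z w gbar c Q : ℝ) (ha : 0 ≤ aplus) (hw : 0 < w)
    (hN : N ≤ aplus * w * (Q * F / w + Z * gbar - c * Z * gbar)) (hc : 1 ≤ c) (hg : 0 ≤ gbar)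
    (hZ : 0 ≤ Z) : N ≤ Q * aplus * F := by
  have e : aplus * w * (Q * F / w + Z * gbar - c * Z * gbar)
      = Q * aplus * F - aplus * w * Z * gbar * (c - 1) := by
    field_simp
    ring
  rw [e] at hN
  have h : 0 ≤ aplus * w * Z * gbar * (c - 1) :=
    mul_nonneg (by positivity) (by linarith)
  linarith

/-- Integrated production bound, general sign (`Φ′ ≥ 0` only, so `w Z (−ḡ) ≤ Q F`): `N ≤ c Q α⁺ F`. -/
theorem production_le_cQF (N aplus F Z w gbar c Q : ℝ) (ha : 0 ≤ aplus) (hw : 0 < w)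
    (hN : N ≤ aplus * w * (Q * F / w + Z * gbar - c * Z * gbar)) (hc : 1 ≤ c)
    (hneg : w * Z * (-gbar) ≤ Q * F) : N ≤ c * Q * aplus * F := by
  have e : aplus * w * (Q * F / w + Z * gbar - c * Z * gbar)
      = Q * aplus * F + aplus * (c - 1) * (w * Z * (-gbar)) := by
    field_simp
    ring
  rw [e] at hN
  have h : aplus * (c - 1) * (w * Z * (-gbar)) ≤ aplus * (c - 1) * (Q * F) :=
    mul_le_mul_of_nonneg_left hneg (mul_nonneg ha (by linarith))
  have e2 : Q * aplus * F + aplus * (c - 1) * (Q * F) = c * Q * aplus * F := by ring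
  linarith

/-- Row assembly (E0, first branch): `dF = N + V`, `V ≤ 0`, `N ≤ C α⁺ F` ⇒
`dF + D_F ≤ C α⁺ F` with `D_F = −V ≥ 0`. -/
theorem row_holds (dF N V aplus F C : ℝ) (hdF : dF = N + V) (hV : V ≤ 0)
    (hN : N ≤ C * aplus * F) : dF + (-V) ≤ C * aplus * F ∧ 0 ≤ -V := by
  constructor <;> linarith

/-- THEOREM N20 (A′), upper half: the planar channel value `ℛ = c_P 𝒥 − 𝒟` with
`0 ≤ c_P ≤ c P / Z`, `𝒥 = w Z ḡ`, `ḡ ≤ G⁺`, `𝒟 ≥ m w P` satisfies `ℛ ≤ w P (c G⁺ − m)`. -/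
theorem channel_upper (R J D cP c P Z w gbar Gp m : ℝ) (hR : R = cP * J - D) (hcP0 : 0 ≤ cP)
    (hcP : cP ≤ c * P / Z) (hZ : 0 < Z) (hJ : J = w * Z * gbar) (hw : 0 ≤ w) (hg : gbar ≤ Gp)
    (hGp : 0 ≤ Gp) (hD : m * w * P ≤ D) : R ≤ w * P * (c * Gp - m) := by
  have h1 : cP * (w * Z * gbar) ≤ cP * (w * Z * Gp) := by
    apply mul_le_mul_of_nonneg_left _ hcP0
    exact mul_le_mul_of_nonneg_left hg (by positivity)
  have h2 : cP * (w * Z * Gp) ≤ (c * P / Z) * (w * Z * Gp) :=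
    mul_le_mul_of_nonneg_right hcP (by positivity)
  have e : (c * P / Z) * (w * Z * Gp) = c * P * w * Gp := by field_simp
  have e2 : w * P * (c * Gp - m) = c * P * w * Gp - m * w * P := by ring
  rw [hR, hJ, e2]
  linarith

/-- In the kill regime `m ≤ c G⁺` (channel open or critical) with `m > 0`: margin `ℛ/𝒟 ≤ c G⁺/m − 1`. -/
theorem margin_upper (R D c Gp m wP : ℝ) (hm : 0 < m) (hD : m * wP ≤ D)
    (hDpos : 0 < D) (hR : R ≤ wP * (c * Gp - m)) (hkill : m ≤ c * Gp) :
    R / D ≤ c * Gp / m - 1 := by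
  rw [div_le_iff₀ hDpos]
  have hwP' : wP ≤ D / m := by
    rw [le_div_iff₀ hm]; linarith
  have h1 : wP * (c * Gp - m) ≤ (D / m) * (c * Gp - m) :=
    mul_le_mul_of_nonneg_right hwP' (by linarith)
  have e : (D / m) * (c * Gp - m) = (c * Gp / m - 1) * D := by
    field_simp
  linarith

/-! ### The K0 instance EΦ.q=2.·.j=1: Φ(x) = x² log(e + x) -/

/-- `Φ″` for Φ = x² log(e+x): `2ℓ + 4ρ − ρ²`, ℓ = log(e+x), ρ = x/(e+x). -/
noncomputable def phi2 (x : ℝ) : ℝ :=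
  2 * Real.log (Real.exp 1 + x) + 4 * (x / (Real.exp 1 + x)) - (x / (Real.exp 1 + x)) ^ 2

/-- `g_Φ = (xΦ′ − 2Φ)/x² = ρ` for Φ = x² log(e+x). -/
noncomputable def gPhi (x : ℝ) : ℝ := x / (Real.exp 1 + x)

/-- `g_Φ < 1` everywhere on `x ≥ 0` (so `sup g_Φ ≤ 1`; with `inf Φ″ = 2` the RQ channel
(c = 2) is closed with equality — the surviving row EΦ.q=2.RQ.j=1, THEOREM N19 (b)). -/
theorem gPhi_lt_one (x : ℝ) (hx : 0 ≤ x) : gPhi x < 1 := by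
  unfold gPhi
  have he : 0 < Real.exp 1 := Real.exp_pos 1
  rw [div_lt_one (by linarith)]
  linarith

/-- The LD channel (c = 4) is OPEN for Φ = x² log(e+x): `Φ″(e/10) < 4 · g_Φ(3e)` (= 3), hence
EΦ.q=2.LD.j=1 is DEAD ∀C by THEOREM N20 (A) (witness of record: nogo TSa, census-1 W2-6401). -/
theorem ld_q2j1_channel_open : phi2 (Real.exp 1 / 10) < 4 * gPhi (3 * Real.exp 1) := by
  have he : 0 < Real.exp 1 := Real.exp_pos 1
  have hg : gPhi (3 * Real.exp 1) = 3 / 4 := by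
    unfold gPhi
    field_simp
    ring
  have hρ : Real.exp 1 / 10 / (Real.exp 1 + Real.exp 1 / 10) = 1 / 11 := by
    field_simp
    ring
  have hℓ : Real.log (Real.exp 1 + Real.exp 1 / 10) = 1 + Real.log (11 / 10) := by
    have e : Real.exp 1 + Real.exp 1 / 10 = Real.exp 1 * (11 / 10) := by ring
    rw [e, Real.log_mul (ne_of_gt he) (by norm_num), Real.log_exp]
  have hlog : Real.log (11 / 10 : ℝ) ≤ 11 / 10 - 1 :=
    Real.log_le_sub_one_of_pos (by norm_num)
  unfold phi2
  rw [hρ, hℓ, hg]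
  nlinarith [hlog]

end Summit.NavierStokesRegularity.FunctionalMining.NoGo.ViscousChannel
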